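import Summits.ResolutionOfSingularities.ResolutionOfSingularities.Theorems.FrobeniusClosingPatchingRelPerfectMonomialPolyhedraGameGowardF
import HarnessLib

/-!
# Crux `PatchingRelPerfect` (stmt-ResolutionOfSingularities-16161), chain w52 — TargetsF3 (m) «M2-strong»,
# COMBINATORIAL HALF, Route F file F2b: PERSISTENCE of `F`-comparability under moves

[OURS · L1 W5.2 · background line; res-L1-w52-stub-4 g3 ROUTE-F memo §2(a)(b), kernel form; fact-free; nothing
here is a statement of the manuscript under review]

`F`-comparability of two generators (file F2 `…MonomialPolyhedraGameGowardF.lean`) survives every move whose centre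
carries equal NON-free weights of the two generators (`FComparable.move_of_weight_eq`): in particular every centre
inside `F` (`FComparable.move_of_subset` — Phase A / FINAL of ROUTE-F) and the MIXED centres `insert f T°` for two
members of the Z-class of `T°` (`FComparable.move_mixed` — Phase B, ROUTE-F §2(b)).

## References

* J. Kollár, *Lectures on Resolution of Singularities* (2007), (3.111) Step 3. [Kollar2007]
-/

-- `Summit.<Summit>.<Sub>.Theorems` with `Sub = Summit` (single-conjunct summit, D-0017)
set_option linter.dupNamespace false

namespace Summit.ResolutionOfSingularities.ResolutionOfSingularities.Theorems

namespace PolyhedraGame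

open Finset

/-! ## Persistence of `F`-comparability -/

section Persistence

variable {s : State} {F J : Finset ℕ} {N c : ℕ} {γ δ : ℕ →₀ ℕ}

/-- [OURS] The weight on `J` splits into the free and the non-free part. -/
theorem weight_eq_inter_add_sdiff (J F : Finset ℕ) (γ : ℕ →₀ ℕ) :
    weight J γ = weight (J ∩ F) γ + weight (J \ F) γ := by
  rw [weight, weight, weight, Finset.sum_inter_add_sum_sdiff J F]

/-- [OURS] One direction of the chart comparison: `γ ≤ δ` on the free part of the parent and equal non-free weights
on the centre give `moveExp γ ≤ moveExp δ` on the free part of the chart. -/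
theorem moveExp_le_on_chart_inter (hs : s.WF) (hN : N ∉ s.B) (hγ : γ ∈ s.A) (hδ : δ ∈ s.A) {T₀ : Finset ℕ}
    (hT₀ : T₀ ⊆ s.B) (hw : weight (J \ F) γ = weight (J \ F) δ)
    (h : ∀ i ∈ (T₀ ∪ J) ∩ F, γ i ≤ δ i) :
    ∀ i ∈ insert N (T₀ ∩ F), moveExp J N c γ i ≤ moveExp J N c δ i := by
  intro i hi
  rcases Finset.mem_insert.mp hi with rfl | hi
  · rw [moveExp_apply_self γ fun h' => hN (hs.support_subset γ hγ h'),
      moveExp_apply_self δ fun h' => hN (hs.support_subset δ hδ h'),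
      weight_eq_inter_add_sdiff J F γ, weight_eq_inter_add_sdiff J F δ, hw]
    refine Nat.sub_le_sub_right (Nat.add_le_add_right (Finset.sum_le_sum fun j hj => h j ?_) _) c
    exact Finset.mem_inter.mpr ⟨Finset.mem_union_right _ (Finset.mem_inter.mp hj).1, (Finset.mem_inter.mp hj).2⟩
  · have hiB : i ∈ s.B := hT₀ (Finset.mem_inter.mp hi).1
    rw [moveExp_apply_of_mem_B hN γ hiB, moveExp_apply_of_mem_B hN δ hiB]
    exact h i (Finset.mem_inter.mpr ⟨Finset.mem_union_left _ (Finset.mem_inter.mp hi).1, (Finset.mem_inter.mp hi).2⟩)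

/-- [OURS] **`F`-comparability persists under a move whose centre carries equal non-free weights of the two
generators** — in particular under every centre `J ⊆ F` (Phase A / FINAL of ROUTE-F) and under the mixed centres
`insert f T°` for two members of the Z-class of `T°` (Phase B, ROUTE-F §2(b)). -/
theorem FComparable.move_of_weight_eq (hs : s.WF) (hN : N ∉ s.B) (hγ : γ ∈ s.A) (hδ : δ ∈ s.A)
    (hw : weight (J \ F) γ = weight (J \ F) δ) (h : FComparable s F γ δ) :
    FComparable (move s J N c) (insert N F) (moveExp J N c γ) (moveExp J N c δ) := by
  intro S' hS'
  by_cases hNS' : N ∈ S'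
  · rcases mem_moveStrata_iff.mp hS' with ⟨hold, -⟩ | ⟨T₀, hT₀, -, hT₀J, rfl⟩
    · exact absurd (hs.str_subset S' hold hNS') hN
    · have hT₀B : T₀ ⊆ s.B := hs.str_subset T₀ hT₀
      have hNT₀ : N ∉ T₀ := fun h' => hN (hT₀B h')
      have hSF : insert N T₀ ∩ insert N F = insert N (T₀ ∩ F) := by
        ext i
        simp only [Finset.mem_inter, Finset.mem_insert]
        constructor
        · rintro ⟨h1 | h1, h2 | h2⟩
          · exact Or.inl h1
          · exact Or.inl h1
          · exact Or.inl h2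
          · exact Or.inr ⟨h1, h2⟩
        · rintro (h1 | ⟨h1, h2⟩)
          · exact ⟨Or.inl h1, Or.inl h1⟩
          · exact ⟨Or.inr h1, Or.inr h2⟩
      rw [hSF]
      rcases h _ hT₀J with hle | hle
      · exact Or.inl (moveExp_le_on_chart_inter hs hN hγ hδ hT₀B hw hle)
      · exact Or.inr (moveExp_le_on_chart_inter hs hN hδ hγ hT₀B hw.symm hle)
  · obtain ⟨hold, -⟩ := mem_str_of_mem_move_str_of_not_mem hS' hNS'
    have hSF : S' ∩ insert N F = S' ∩ F := by
      ext i
      simp only [Finset.mem_inter, Finset.mem_insert]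
      exact ⟨fun ⟨h1, h2⟩ => ⟨h1, h2.resolve_left fun h' => hNS' (h' ▸ h1)⟩, fun ⟨h1, h2⟩ => ⟨h1, Or.inr h2⟩⟩
    rw [hSF]
    have hNSF : N ∉ S' ∩ F := fun h' => hNS' (Finset.mem_inter.mp h').1
    exact (comparableOn_moveExp_iff hNSF γ δ).mpr (h S' hold)

/-- [OURS] **`F`-comparability persists under every move with centre inside `F`.** -/
theorem FComparable.move_of_subset (hs : s.WF) (hN : N ∉ s.B) (hγ : γ ∈ s.A) (hδ : δ ∈ s.A) (hJF : J ⊆ F)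
    (h : FComparable s F γ δ) :
    FComparable (move s J N c) (insert N F) (moveExp J N c γ) (moveExp J N c δ) :=
  h.move_of_weight_eq hs hN hγ hδ (by rw [Finset.sdiff_eq_empty_iff_subset.mpr hJF]; rfl)

/-- [OURS] **`F`-comparability persists under the mixed centre `insert f T°`** (`f ∈ F`, `T°` disjoint from `F`) for
two generators of equal weight on `T°`. -/
theorem FComparable.move_mixed (hs : s.WF) (hN : N ∉ s.B) (hγ : γ ∈ s.A) (hδ : δ ∈ s.A) {f : ℕ} {T₀ : Finset ℕ}
    (hf : f ∈ F) (hT₀F : Disjoint T₀ F) (hw : weight T₀ γ = weight T₀ δ) (h : FComparable s F γ δ) :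
    FComparable (move s (insert f T₀) N c) (insert N F) (moveExp (insert f T₀) N c γ)
      (moveExp (insert f T₀) N c δ) := by
  refine h.move_of_weight_eq hs hN hγ hδ ?_
  have : insert f T₀ \ F = T₀ := by
    ext i
    simp only [Finset.mem_sdiff, Finset.mem_insert]
    constructor
    · rintro ⟨h1 | h1, h2⟩
      · exact absurd (h1 ▸ hf) h2
      · exact h1
    · intro h1; exact ⟨Or.inr h1, Finset.disjoint_left.mp hT₀F h1⟩
  rw [this, hw]

end Persistence

end PolyhedraGame

end Summit.ResolutionOfSingularities.ResolutionOfSingularities.Theorems
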